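import Literature.AlgebraicGeometry.Morphisms.CechModuleH2RefinementLemmas
import HarnessLib

/-!
# Index-independence of the refinement map on `Ȟ²` (the prism homotopy between two refinement maps)

Layer `Literature/AlgebraicGeometry/Morphisms`, namespace `Literature.AlgebraicGeometry.Morphisms`.  THEOREMS ONLY
(no definition, no named fact, no instance).  Sequel of `CechModuleH2Refinement.lean` /
`CechModuleH2RefinementLemmas.lean`: for a sheaf of `𝒪_X`-modules `M` on an `A`-scheme `f : X → Spec A`, two
families of opens `𝒰 = (U_i)_{i ∈ ι}`, `𝒱 = (V_j)_{j ∈ ι'}` and TWO maps of index sets `τ₁, τ₂ : ι' → ι` with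
`V_j ⊆ U_{τ₁ j}` and `V_j ⊆ U_{τ₂ j}`, the two refinement maps `ρ_{τ₁}, ρ_{τ₂} : Č²(𝒰, M) → Č²(𝒱, M)` agree on
`2`-cocycles up to `2`-coboundaries:

* `refineC2_sub_refineC2_eq_cechMD1` — the explicit prism: for a `2`-cocycle `z`,
  `ρ_{τ₁} z − ρ_{τ₂} z = d¹ h` with `h_{jl} = z_{τ₁ j, τ₁ l, τ₂ l}| − z_{τ₁ j, τ₂ j, τ₂ l}|`;
* `refineC2_sub_refineC2_mem_cechMB2` — hence `ρ_{τ₁} z − ρ_{τ₂} z ∈ B̌²(𝒱, M)`;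
* `CechMH2.mk_refineC2_eq_mk_refineC2` — the class form: `[ρ_{τ₁} z] = [ρ_{τ₂} z]` in `Ȟ²(𝒱, M)`, i.e. the map
  `Ȟ²(𝒰, M) → Ȟ²(𝒱, M)` induced by a refinement does not depend on the choice of the refinement map
  (The Stacks Project, Tag 01FP; Görtz–Wedhorn II (21.16), Lemma 21.72).

The proof is the standard chain homotopy `(h z)_{j₀…j_{p-1}} = Σ_i (−1)^i z_{τ₁ j₀ … τ₁ j_i, τ₂ j_i … τ₂ j_{p-1}}|`
in degree `2`, checked against the three restricted cocycle identities (★ `cechMZ2.cocycle_res` of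
`CechModuleH2TwoCovers.lean`) on the quadruples `(τ₁j, τ₁l, τ₁m, τ₂m)`, `(τ₁j, τ₁l, τ₂l, τ₂m)`,
`(τ₁j, τ₂j, τ₂l, τ₂m)`.  Any `M`, any base ring `A`, no finiteness or affineness hypothesis.
Everything is proved; Mathlib searched (pin v4.32): no Čech cohomology of sheaves of modules on schemes
(cf. `CechModuleRefinement.lean`).  Cell `hodgecm-mathlib` (D-0151), F-11 α1 / J4-(iv) road (a′) brick (N2)
of F0P1b-p01 (g2)'s (iv-4) plan (consumed twice by the `[2]^* = 4` assembly (N4)); generic and count-neutral —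
HC_CM is proved only modulo the 7 printed citations until rung 0 closes, and nothing here refers to it.

## References

* The Stacks Project, Tag 01FP (Cohomology, Lemma 20.11.x: two refinement maps induce the same map on Čech
  cohomology — the maps of complexes are homotopic), Tag 09UY, Tag 01ED. [StacksProject]
* U. Görtz, T. Wedhorn, *Algebraic Geometry II: Cohomology of Schemes*, Springer Spektrum (2023),
  doi:10.1007/978-3-658-43031-3: (21.16) Def. 21.71 and Lemma 21.72, p. 181 (maps of coverings; two refinement maps induce the same map on Čech cohomology). [GortzWedhorn2023]
-/

noncomputable section

open CategoryTheory AlgebraicGeometry Limits TopologicalSpace Opposite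

universe u v w

namespace Literature.AlgebraicGeometry.Morphisms

variable {A : Type u} [CommRing A] {X : Scheme.{u}} (f : X ⟶ Spec (.of A)) (M : X.Modules)

section Prism

variable {ι : Type v} {ι' : Type w} (U : ι → X.Opens) (V : ι' → X.Opens) (τ₁ τ₂ : ι' → ι)
  (h₁ : ∀ j, V j ≤ U (τ₁ j)) (h₂ : ∀ j, V j ≤ U (τ₂ j))

/-- **The prism between two refinement maps, degree `2`**: for a `2`-cocycle `z` of `M` on `𝒰` and two maps of
index sets `τ₁, τ₂ : 𝒱 → 𝒰` (`V_j ⊆ U_{τ₁ j}`, `V_j ⊆ U_{τ₂ j}`), `ρ_{τ₁} z − ρ_{τ₂} z = d¹ h` for the `1`-cochain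
`h_{jl} = z_{τ₁ j, τ₁ l, τ₂ l}|_{V_j ∩ V_l} − z_{τ₁ j, τ₂ j, τ₂ l}|_{V_j ∩ V_l}`.
[cite: StacksProject, Tag 01FP] [cite: GortzWedhorn2023, (21.16) Lemma 21.72 (p. 181)] -/
theorem refineC2_sub_refineC2_eq_cechMD1 {z : CechMC2 f M U} (hz : z ∈ cechMZ2 f M U) :
    cechMRefineC2 f M U V τ₁ h₁ z - cechMRefineC2 f M U V τ₂ h₂ z =
      cechMD1 f M V fun j l =>
        MSections.res f M (le_inf (le_inf (inf_le_left.trans (h₁ j)) (inf_le_right.trans (h₁ l)))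
            (inf_le_right.trans (h₂ l))) (z (τ₁ j) (τ₁ l) (τ₂ l)) -
          MSections.res f M (le_inf (le_inf (inf_le_left.trans (h₁ j)) (inf_le_left.trans (h₂ j)))
            (inf_le_right.trans (h₂ l))) (z (τ₁ j) (τ₂ j) (τ₂ l)) := by
  funext j l m
  -- the six inclusions of `W := V_j ∩ V_l ∩ V_m` into the members of `𝒰` that occur
  have pA : V j ⊓ V l ⊓ V m ≤ U (τ₁ j) := (inf_le_left.trans inf_le_left).trans (h₁ j)
  have pB : V j ⊓ V l ⊓ V m ≤ U (τ₁ l) := (inf_le_left.trans inf_le_right).trans (h₁ l)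
  have pC : V j ⊓ V l ⊓ V m ≤ U (τ₁ m) := inf_le_right.trans (h₁ m)
  have pA' : V j ⊓ V l ⊓ V m ≤ U (τ₂ j) := (inf_le_left.trans inf_le_left).trans (h₂ j)
  have pB' : V j ⊓ V l ⊓ V m ≤ U (τ₂ l) := (inf_le_left.trans inf_le_right).trans (h₂ l)
  have pC' : V j ⊓ V l ⊓ V m ≤ U (τ₂ m) := inf_le_right.trans (h₂ m)
  -- the three restricted cocycle identities
  have e1 := cechMZ2.cocycle_res f M U hz (τ₁ j) (τ₁ l) (τ₁ m) (τ₂ m) pA pB pC pC'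
  have e2 := cechMZ2.cocycle_res f M U hz (τ₁ j) (τ₁ l) (τ₂ l) (τ₂ m) pA pB pB' pC'
  have e3 := cechMZ2.cocycle_res f M U hz (τ₁ j) (τ₂ j) (τ₂ l) (τ₂ m) pA pA' pB' pC'
  simp only [Pi.sub_apply, cechMD1_apply, cechMRefineC2_apply, map_sub, MSections.res_res]
  rw [← sub_eq_zero]
  -- `(ρ₁ z − ρ₂ z)_{jlm} − (d¹ h)_{jlm} = −(e1) + (e2) − (e3)` in the additive group of sections on `W`
  calc
    _ = -(MSections.res f M (le_inf (le_inf pB pC) pC') (z (τ₁ l) (τ₁ m) (τ₂ m)) -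
            MSections.res f M (le_inf (le_inf pA pC) pC') (z (τ₁ j) (τ₁ m) (τ₂ m)) +
            MSections.res f M (le_inf (le_inf pA pB) pC') (z (τ₁ j) (τ₁ l) (τ₂ m)) -
            MSections.res f M (le_inf (le_inf pA pB) pC) (z (τ₁ j) (τ₁ l) (τ₁ m))) +
          (MSections.res f M (le_inf (le_inf pB pB') pC') (z (τ₁ l) (τ₂ l) (τ₂ m)) -
            MSections.res f M (le_inf (le_inf pA pB') pC') (z (τ₁ j) (τ₂ l) (τ₂ m)) +
            MSections.res f M (le_inf (le_inf pA pB) pC') (z (τ₁ j) (τ₁ l) (τ₂ m)) -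
            MSections.res f M (le_inf (le_inf pA pB) pB') (z (τ₁ j) (τ₁ l) (τ₂ l))) -
          (MSections.res f M (le_inf (le_inf pA' pB') pC') (z (τ₂ j) (τ₂ l) (τ₂ m)) -
            MSections.res f M (le_inf (le_inf pA pB') pC') (z (τ₁ j) (τ₂ l) (τ₂ m)) +
            MSections.res f M (le_inf (le_inf pA pA') pC') (z (τ₁ j) (τ₂ j) (τ₂ m)) -
            MSections.res f M (le_inf (le_inf pA pA') pB') (z (τ₁ j) (τ₂ j) (τ₂ l))) := by
        abel
    _ = 0 := by rw [e1, e2, e3, neg_zero, zero_add, sub_zero]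

/-- **Two refinement maps agree on `2`-cocycles up to `2`-coboundaries**: `ρ_{τ₁} z − ρ_{τ₂} z ∈ B̌²(𝒱, M)`
for every `2`-cocycle `z` of `M` on `𝒰`. [cite: StacksProject, Tag 01FP]
[cite: GortzWedhorn2023, (21.16) Lemma 21.72 (p. 181)] -/
theorem refineC2_sub_refineC2_mem_cechMB2 {z : CechMC2 f M U} (hz : z ∈ cechMZ2 f M U) :
    cechMRefineC2 f M U V τ₁ h₁ z - cechMRefineC2 f M U V τ₂ h₂ z ∈ cechMB2 f M V := by
  rw [mem_cechMB2_iff, refineC2_sub_refineC2_eq_cechMD1 f M U V τ₁ τ₂ h₁ h₂ hz]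
  exact ⟨_, rfl⟩

/-- **Index-independence of `Ȟ²(𝒰, M) → Ȟ²(𝒱, M)`** (class form): for a `2`-cocycle `z` on `𝒰` and two maps of
index sets `τ₁, τ₂` exhibiting `𝒱` as a refinement of `𝒰`, `[ρ_{τ₁} z] = [ρ_{τ₂} z]` in `Ȟ²(𝒱, M)`.
[cite: StacksProject, Tag 01FP] [cite: GortzWedhorn2023, (21.16) Lemma 21.72 (p. 181)] -/
theorem CechMH2.mk_refineC2_eq_mk_refineC2 (z : cechMZ2 f M U) :
    CechMH2.mk f M V ⟨cechMRefineC2 f M U V τ₁ h₁ z, refineMC2_mem_cechMZ2 f M U V τ₁ h₁ z.2⟩ =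
      CechMH2.mk f M V ⟨cechMRefineC2 f M U V τ₂ h₂ z, refineMC2_mem_cechMZ2 f M U V τ₂ h₂ z.2⟩ := by
  rw [CechMH2.mk_eq_mk_iff]
  exact refineC2_sub_refineC2_mem_cechMB2 f M U V τ₁ τ₂ h₁ h₂ z.2

end Prism

end Literature.AlgebraicGeometry.Morphisms

end
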